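import Summits.HubbardSuperconductivity.HubbardSuperconductivity.Theorems.NoGoSingletPairSpinAlgebra
import Literature.MathematicalPhysics.QuantumLattice.FermionHopAmplitudeBound
import Literature.MathematicalPhysics.QuantumLattice.HubbardGaugeBound
import Literature.MathematicalPhysics.QuantumLattice.PairCorrelations

/-!
# `LowEnergyRigidity` (crux stmt-HubbardSuperconductivity-1892, route `DeformationLadder`), spin squeeze I:
# the kinematic bound `‖Δ_g ψ‖² ≤ 2 K_g² L² N↓ ‖ψ‖²` on the sectors `(N↑, N↓)`

First of three negative-side support files (line lead a1; hand-off (a) of crux-ideate r2 k6, typed with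
`sorry` as `re_expect_pairField_le_of_spinSq` in the crux folder's `SketchIdeator6.lean`). Here: every
term of the singlet pair field `Δ_g = Σ_x Σ_e (g e/√2)(c_{x↑}c_{x+e,↓} - c_{x↓}c_{x+e,↑})` carries one
DOWN annihilator, so with `‖c‖ ≤ 1`, the pure CAR, Cauchy–Schwarz over the `L²` sites and
`Σ_x ‖c_{x↓}ψ‖² = N↓ ‖ψ‖²` one gets, on the coordinate sector `(N↑, N↓) = (a, b)` of the fermionic torus,

* `ss_re_expect_pairField_le_of_isInSector` — `Re⟨ψ, Δ_gᴴΔ_g ψ⟩ ≤ 2 K_g² L² · b · ‖ψ‖²`, `K_g = Σ_e |g e|`;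
* `pairField_dWave_sector_bound` — `Re⟨ψ, Δ_dᴴΔ_d ψ⟩ ≤ 32 L² · b · ‖ψ‖²` (`K_d = 4`).

(The sharper constant `8` for `L ≥ 3` — group `Δ_d = Σ_y c(F_y) c_{y↓}` with `‖F_y‖² = 8` and use
`‖c(F)‖ ≤ ‖F‖₂` — is not needed downstream.) Sequel files: `…SpinSqueeze` (the `SU(2)` raising argument and
the squeeze `Re⟨Δ_dᴴΔ_d⟩_φ ≤ 32L²(N/2 - S)‖φ‖²`) and `…SpinSqueezeWindow` (consequences for the crux's
rigidity matrix). Nothing is (re)defined; no named facts.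

References: O. Bratteli, D. W. Robinson, *OAQSM II* §5.2.2 (`‖a(f)‖ ≤ ‖f‖`, CAR); E. H. Lieb, PRL 62
(1989) 1201, eq. (2) (sectors); D. J. Scalapino, Phys. Rep. 250 (1995) 329 §2 (the pair field). Folklore.
-/

set_option linter.dupNamespace false

noncomputable section

namespace Summit.HubbardSuperconductivity.HubbardSuperconductivity.Theorems.DeformationLadder

open Matrix Finset Literature.MathematicalPhysics.QuantumLattice Literature.Probability.LatticeModels
open scoped Matrix.Norms.L2Operator ComplexOrder

/-! ### Norm bookkeeping on a fermionic Fock space -/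

section Fock

variable {ι : Type*} [LinearOrder ι] [Fintype ι]

/-- `‖c_i v‖₂ ≤ ‖v‖₂` (`‖c_i‖ ≤ 1`). Bratteli–Robinson II §5.2.2. [folklore] -/
theorem ss_eucNorm_annihilation_mulVec_le (i : ι) (v : Fock ι) :
    eucNorm (annihilation i *ᵥ v) ≤ eucNorm v := by
  refine (eucNorm_mulVec_le _ _).trans ?_
  have h := norm_annihilation_le_one (ι := ι) i
  have h0 := eucNorm_nonneg v
  nlinarith

omit [LinearOrder ι] in
/-- Triangle inequality for finite sums in `‖·‖₂`. [folklore] -/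
theorem ss_eucNorm_sum_le {α : Type*} (s : Finset α) (v : α → Fock ι) :
    eucNorm (∑ a ∈ s, v a) ≤ ∑ a ∈ s, eucNorm (v a) := by
  classical
  induction s using Finset.induction_on with
  | empty => simp
  | insert a s ha ih =>
    rw [Finset.sum_insert ha, Finset.sum_insert ha]
    exact (eucNorm_add_le _ _).trans (by linarith)

/-- `c_i c_j v = - c_j c_i v` (pure CAR). Bratteli–Robinson II §5.2.2. [folklore] -/
theorem ss_annihilation_annihilation_mulVec (i j : ι) (v : Fock ι) :
    annihilation i *ᵥ (annihilation j *ᵥ v) = -(annihilation j *ᵥ (annihilation i *ᵥ v)) := by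
  have h := annihilation_anticommute_holds (ι := ι) i j
  rw [mulVec_mulVec, mulVec_mulVec, ← neg_mulVec, eq_neg_of_add_eq_zero_left h]

omit [LinearOrder ι] in
/-- `Re ⟨ψ, ψ⟩ = Σ_s |ψ s|²`. [folklore] -/
theorem ss_re_star_dotProduct_self (ψ : Fock ι) :
    (star ψ ⬝ᵥ ψ).re = ∑ s : Finset ι, ‖ψ s‖ ^ 2 := by
  rw [dotProduct, Complex.re_sum]
  refine Finset.sum_congr rfl fun s _ => ?_
  rw [Pi.star_apply, Complex.star_def, Complex.conj_mul', ← Complex.ofReal_pow, Complex.ofReal_re]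

/-- `Re ⟨ψ, D ψ⟩ = Σ_s d_s |ψ s|²` for a real diagonal matrix `D = diag(d)`. [folklore] -/
theorem ss_re_star_dotProduct_diagonal_mulVec (d : Finset ι → ℝ) (ψ : Fock ι) :
    (star ψ ⬝ᵥ (diagonal (fun s => ((d s : ℝ) : ℂ)) *ᵥ ψ)).re = ∑ s : Finset ι, d s * ‖ψ s‖ ^ 2 := by
  rw [dotProduct, Complex.re_sum]
  refine Finset.sum_congr rfl fun s _ => ?_
  rw [mulVec_diagonal, Pi.star_apply, Complex.star_def, mul_left_comm, Complex.conj_mul',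
    ← Complex.ofReal_pow, ← Complex.ofReal_mul, Complex.ofReal_re]

end Fock

/-! ### Sector bookkeeping: the number of down electrons -/

section Sector

variable {Λ : Type*} [LinearOrder Λ] [Fintype Λ]

/-- `‖c_{y↓} ψ‖² = Σ_s [y↓ ∈ s] |ψ s|²`. [folklore] -/
theorem ss_eucNorm_annihilation_down_sq (y : Λ) (ψ : Fock (Orb Λ)) :
    eucNorm (annihilation (orb y 1) *ᵥ ψ) ^ 2 =
      ∑ s : Finset (Orb Λ), (if orb y 1 ∈ s then (1 : ℝ) else 0) * ‖ψ s‖ ^ 2 := by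
  have hfun : (fun s : Finset (Orb Λ) => (if orb y 1 ∈ s then (1 : ℂ) else 0)) =
      fun s => (((if orb y 1 ∈ s then (1 : ℝ) else 0 : ℝ)) : ℂ) := by
    funext s; split_ifs <;> simp
  rw [eucNorm_annihilation_mulVec_sq,
    show (creation (orb y 1) * annihilation (orb y 1) : Matrix _ _ ℂ) = numberOp y 1 from rfl,
    LiebThm1.numberOp_eq_diagonal, hfun, ss_re_star_dotProduct_diagonal_mulVec]

/-- **`Σ_y ‖c_{y↓} ψ‖² = N↓ ‖ψ‖²` on the sector `(N↑, N↓) = (a, b)`.** Lieb, PRL 62 (1989) 1201,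
eq. (2). [folklore] -/
theorem ss_sum_eucNorm_annihilation_down_sq {a b : ℕ} {ψ : Fock (Orb Λ)} (hψ : IsInSector a b ψ) :
    ∑ y : Λ, eucNorm (annihilation (orb y 1) *ᵥ ψ) ^ 2 = b * (star ψ ⬝ᵥ ψ).re := by
  simp_rw [ss_eucNorm_annihilation_down_sq]
  rw [Finset.sum_comm, ss_re_star_dotProduct_self, Finset.mul_sum]
  refine Finset.sum_congr rfl fun s _ => ?_
  rw [← Finset.sum_mul]
  by_cases hs : (upPart s).card = a ∧ (downPart s).card = b
  · congr 1
    rw [← hs.2, downPart, Finset.card_filter]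
    push_cast
    rfl
  · rw [hψ s hs, norm_zero, zero_pow two_ne_zero, mul_zero, mul_zero]

end Sector

/-! ### The kinematic bound: `‖Δ_g ψ‖² ≤ 2 K_g² L² N↓ ‖ψ‖²` -/

section Kinematic

variable (g : Site 2 → ℝ) (L : ℕ) [NeZero L]

/-- The `ℓ¹`-mass `K_g = Σ_{e ∈ {0, ±e₁, ±e₂}} |g e|` of a pair form factor is `≥ 0`. [folklore] -/
theorem ss_formFactorMass_nonneg : 0 ≤ ∑ e ∈ insert 0 unitSteps, |g e| :=
  Finset.sum_nonneg fun _ _ => abs_nonneg _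

/-- `K_d ≤ 4` for the `d_{x²-y²}` form factor (`g 0 = 0`, `|g(±eᵢ)| = 1`). Scalapino (1995) §2. [folklore] -/
theorem ss_formFactorMass_dWave_le : ∑ e ∈ insert 0 unitSteps, |dWaveFormFactor e| ≤ 4 := by
  rw [Finset.sum_insert_of_eq_zero_if_notMem (fun _ => by simp)]
  have h1 : ∀ e ∈ unitSteps, |dWaveFormFactor e| ≤ 1 := by
    intro e _
    unfold dWaveFormFactor
    split_ifs <;> simp
  refine (Finset.sum_le_sum h1).trans ?_
  rw [Finset.sum_const, nsmul_eq_mul, mul_one]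
  have h4 : (unitSteps).card ≤ 4 := Finset.card_le_four
  exact_mod_cast h4

/-- `Δ_g ψ` written out: `Σ_x Σ_e (g e/√2) (c_{x↑} c_{x+e,↓} ψ - c_{x↓} c_{x+e,↑} ψ)`.
Scalapino, Phys. Rep. 250 (1995) 329, §2, eq. (2.2). [folklore] -/
theorem ss_pairField_mulVec_eq (ψ : Fock (Orb (FermionTorus 2 L))) :
    pairField g L *ᵥ ψ = ∑ x : TorusSite 2 L, ∑ e ∈ insert 0 unitSteps, ((g e / Real.sqrt 2 : ℝ) : ℂ) •
        (annihilation (orb (FermionTorus.ofTorusSite x) 0) *ᵥ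
            (annihilation (orb (FermionTorus.ofTorusSite (x + Torus.proj L e)) 1) *ᵥ ψ) -
          annihilation (orb (FermionTorus.ofTorusSite x) 1) *ᵥ
            (annihilation (orb (FermionTorus.ofTorusSite (x + Torus.proj L e)) 0) *ᵥ ψ)) := by
  simp only [pairField, localPair, Matrix.sum_mulVec, Matrix.smul_mulVec, Matrix.sub_mulVec,
    ← Matrix.mulVec_mulVec]

/-- **First-order bound**: `‖Δ_g ψ‖₂ ≤ √2 K_g Σ_x ‖c_{x↓} ψ‖₂` — every term of `Δ_g` contains one
down annihilator, and `‖c‖ ≤ 1`. Bratteli–Robinson II §5.2.2. [folklore] -/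
theorem ss_eucNorm_pairField_mulVec_le (ψ : Fock (Orb (FermionTorus 2 L))) :
    eucNorm (pairField g L *ᵥ ψ) ≤ Real.sqrt 2 * (∑ e ∈ insert 0 unitSteps, |g e|) *
      ∑ x : TorusSite 2 L, eucNorm (annihilation (orb (FermionTorus.ofTorusSite x) 1) *ᵥ ψ) := by
  set A : TorusSite 2 L → ℝ := fun x => eucNorm (annihilation (orb (FermionTorus.ofTorusSite x) 1) *ᵥ ψ)
    with hA
  have hA0 : ∀ x, 0 ≤ A x := fun x => eucNorm_nonneg _
  -- termwise bound
  have hterm : ∀ (x : TorusSite 2 L) (e : Site 2),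
      eucNorm (((g e / Real.sqrt 2 : ℝ) : ℂ) •
        (annihilation (orb (FermionTorus.ofTorusSite x) 0) *ᵥ
            (annihilation (orb (FermionTorus.ofTorusSite (x + Torus.proj L e)) 1) *ᵥ ψ) -
          annihilation (orb (FermionTorus.ofTorusSite x) 1) *ᵥ
            (annihilation (orb (FermionTorus.ofTorusSite (x + Torus.proj L e)) 0) *ᵥ ψ))) ≤
        |g e| / Real.sqrt 2 * (A (x + Torus.proj L e) + A x) := by
    intro x e
    rw [eucNorm_smul, Complex.norm_real, Real.norm_eq_abs, abs_div,
      abs_of_pos (Real.sqrt_pos.2 (by norm_num : (0:ℝ) < 2))]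
    refine mul_le_mul_of_nonneg_left ?_ (by positivity)
    refine (eucNorm_sub_le _ _).trans (add_le_add ?_ ?_)
    · exact (ss_eucNorm_annihilation_mulVec_le _ _).trans le_rfl
    · rw [ss_annihilation_annihilation_mulVec, eucNorm_neg]
      exact ss_eucNorm_annihilation_mulVec_le _ _
  rw [ss_pairField_mulVec_eq]
  refine (ss_eucNorm_sum_le _ _).trans ?_
  refine (Finset.sum_le_sum fun x _ => (ss_eucNorm_sum_le _ _).trans
    (Finset.sum_le_sum fun e _ => hterm x e)).trans ?_
  -- Σ_x Σ_e |g e|/√2 (A(x+e) + A x) = Σ_e |g e|/√2 · 2 Σ_x A x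
  rw [Finset.sum_comm]
  have hshift : ∀ e : Site 2, ∑ x : TorusSite 2 L, A (x + Torus.proj L e) = ∑ x : TorusSite 2 L, A x :=
    fun e => Fintype.sum_equiv (Equiv.addRight (Torus.proj L e)) _ _ fun _ => rfl
  have hinner : ∀ e : Site 2, ∑ x : TorusSite 2 L, |g e| / Real.sqrt 2 * (A (x + Torus.proj L e) + A x) =
      |g e| / Real.sqrt 2 * (2 * ∑ x : TorusSite 2 L, A x) := by
    intro e
    rw [← Finset.mul_sum, Finset.sum_add_distrib, hshift, two_mul]
  simp_rw [hinner]
  rw [← Finset.sum_mul, ← Finset.sum_div]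
  have hs : Real.sqrt 2 * Real.sqrt 2 = 2 := Real.mul_self_sqrt (by norm_num)
  have hs0 : 0 < Real.sqrt 2 := Real.sqrt_pos.2 (by norm_num)
  have hD : 0 ≤ ∑ x : TorusSite 2 L, A x := Finset.sum_nonneg fun x _ => hA0 x
  have hK : 0 ≤ ∑ e ∈ insert 0 unitSteps, |g e| := Finset.sum_nonneg fun _ _ => abs_nonneg _
  have h22 : (2 : ℝ) / Real.sqrt 2 = Real.sqrt 2 := by rw [div_eq_iff hs0.ne', hs]
  refine le_of_eq ?_
  calc (∑ e ∈ insert 0 unitSteps, |g e|) / Real.sqrt 2 * (2 * ∑ x : TorusSite 2 L, A x)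
      = (∑ e ∈ insert 0 unitSteps, |g e|) * (∑ x : TorusSite 2 L, A x) * (2 / Real.sqrt 2) := by ring
    _ = Real.sqrt 2 * (∑ e ∈ insert 0 unitSteps, |g e|) * ∑ x : TorusSite 2 L, A x := by
        rw [h22]; ring

/-- **The kinematic bound, general form factor**: on the sector `(N↑, N↓) = (a, b)`,
`Re⟨ψ, Δ_gᴴ Δ_g ψ⟩ = ‖Δ_g ψ‖² ≤ 2 K_g² L² · b · ‖ψ‖²` (Cauchy–Schwarz over the `L²` sites and
`Σ_x ‖c_{x↓}ψ‖² = N↓ ‖ψ‖²`). Bratteli–Robinson II §5.2.2; Lieb (1989) eq. (2). [folklore] -/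
theorem ss_re_expect_pairField_le_of_isInSector {a b : ℕ} {ψ : Fock (Orb (FermionTorus 2 L))}
    (hψ : IsInSector a b ψ) :
    (expect ((pairField g L)ᴴ * pairField g L) ψ).re ≤
      2 * (∑ e ∈ insert 0 unitSteps, |g e|) ^ 2 * (L : ℝ) ^ 2 * b * (star ψ ⬝ᵥ ψ).re := by
  set A : TorusSite 2 L → ℝ := fun x => eucNorm (annihilation (orb (FermionTorus.ofTorusSite x) 1) *ᵥ ψ)
    with hA
  have h1 : (expect ((pairField g L)ᴴ * pairField g L) ψ).re = eucNorm (pairField g L *ᵥ ψ) ^ 2 := by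
    rw [Literature.MathematicalPhysics.QuantumLattice.expect,
      LiebThm1.star_dotProduct_conjTranspose_mul_mulVec, eucNorm_sq]
  have h2 := ss_eucNorm_pairField_mulVec_le g L ψ
  -- Cauchy–Schwarz over sites
  have h3 : (∑ x : TorusSite 2 L, A x) ^ 2 ≤ (L : ℝ) ^ 2 * ∑ x : TorusSite 2 L, A x ^ 2 := by
    have h := sq_sum_le_card_mul_sum_sq (s := (Finset.univ : Finset (TorusSite 2 L))) (f := A)
    rwa [Finset.card_univ, show Fintype.card (TorusSite 2 L) = L ^ 2 by simp [ZMod.card],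
      Nat.cast_pow] at h
  -- the down number
  have h4 : ∑ x : TorusSite 2 L, A x ^ 2 = b * (star ψ ⬝ᵥ ψ).re := by
    rw [← ss_sum_eucNorm_annihilation_down_sq hψ]
    exact Fintype.sum_equiv FermionTorus.equivTorusSite.symm _ _ fun _ => rfl
  have h5 : 0 ≤ eucNorm (pairField g L *ᵥ ψ) := eucNorm_nonneg _
  have h6 : 0 ≤ Real.sqrt 2 * (∑ e ∈ insert 0 unitSteps, |g e|) * ∑ x : TorusSite 2 L, A x := h5.trans h2
  have hs : Real.sqrt 2 ^ 2 = 2 := Real.sq_sqrt (by norm_num)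
  calc (expect ((pairField g L)ᴴ * pairField g L) ψ).re
      = eucNorm (pairField g L *ᵥ ψ) ^ 2 := h1
    _ ≤ (Real.sqrt 2 * (∑ e ∈ insert 0 unitSteps, |g e|) * ∑ x : TorusSite 2 L, A x) ^ 2 :=
        pow_le_pow_left₀ h5 h2 2
    _ = 2 * (∑ e ∈ insert 0 unitSteps, |g e|) ^ 2 * (∑ x : TorusSite 2 L, A x) ^ 2 := by
        rw [mul_pow, mul_pow, hs]
    _ ≤ 2 * (∑ e ∈ insert 0 unitSteps, |g e|) ^ 2 * ((L : ℝ) ^ 2 * ∑ x : TorusSite 2 L, A x ^ 2) :=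
        mul_le_mul_of_nonneg_left h3 (by positivity)
    _ = 2 * (∑ e ∈ insert 0 unitSteps, |g e|) ^ 2 * (L : ℝ) ^ 2 * b * (star ψ ⬝ᵥ ψ).re := by
        rw [h4]; ring

end Kinematic

section KinematicDWave

/-- **The kinematic bound for the `d`-wave pair field** (registered stub `pairField_dWave_sector_bound`
of the crux's negative line): on the sector `(N↑, N↓) = (a, b)` of the fermionic torus of side `L`,
`Re⟨ψ, Δ_dᴴ Δ_d ψ⟩ ≤ 32 L² · b · ‖ψ‖²`. [folklore] -/
theorem pairField_dWave_sector_bound :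
    ∀ (L : ℕ) [NeZero L] (a b : ℕ) (ψ : Fock (Orb (FermionTorus 2 L))), IsInSector a b ψ →
      (expect ((pairField dWaveFormFactor L)ᴴ * pairField dWaveFormFactor L) ψ).re ≤
        32 * (L : ℝ) ^ 2 * b * (star ψ ⬝ᵥ ψ).re := by
  intro L _ a b ψ hψ
  refine (ss_re_expect_pairField_le_of_isInSector dWaveFormFactor L hψ).trans ?_
  have hK := ss_formFactorMass_dWave_le
  have hK0 := ss_formFactorMass_nonneg dWaveFormFactor
  have hn : 0 ≤ (star ψ ⬝ᵥ ψ).re := by rw [← eucNorm_sq]; positivity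
  have hb : (0 : ℝ) ≤ b := Nat.cast_nonneg b
  have hL : (0 : ℝ) ≤ (L : ℝ) ^ 2 := by positivity
  have hK2 : (∑ e ∈ insert 0 unitSteps, |dWaveFormFactor e|) ^ 2 ≤ 16 := by nlinarith
  have := mul_le_mul_of_nonneg_right (mul_le_mul_of_nonneg_right
    (mul_le_mul_of_nonneg_right hK2 hL) hb) hn
  nlinarith [this]

end KinematicDWave

end Summit.HubbardSuperconductivity.HubbardSuperconductivity.Theorems.DeformationLadder

end
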